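import Mathlib
import HarnessLib
import Summits.HubbardSuperconductivity.HubbardSuperconductivity.Theorems.KLProgrammeKLRegimeEngineTowerRemeasureWtAll
import Summits.HubbardSuperconductivity.HubbardSuperconductivity.Theorems.KLProgrammeKLRegimeEngineNormsJumpLastLegCountUniform
import Literature.NumberTheory.LFunctions.ZetaPartialSumZeroTotal

/-!
# Route `KLProgramme` — crux K3 ENGINE (stmt-HubbardSuperconductivity-20437 `KLRegimeEngineV17F2`), stub (b) v2, THE LEVELS PACKAGE (ℓ), instantiation (I2):
# THE WEIGHTED `_flow_all` JUMP ROWS WITH m-UNIFORM CONSTANTS (located item «(I2)-CONST-UNIFORM», weighted track; cell gate-hubbard-kl, seat p4 g17)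

The weighted window-free jump rows of `…EngineTowerRemeasureWtAll` (p4 g17, File D of «(I2)-WT-WINDOW») take the degree `m` as their first parameter because the count row
they read did; on `card_relCount_prescribed_lastLeg_klAniso_le_window_uniform` the same proofs give the kit-ready forms (overlap constant `CJ(R, c″)` of
`overlapWt_jump_sums_klEng_flow_all` is already m-free):

* **`klWtPinnedSumAt_jump_le_klEng_flow_all_uniform (R) (c″)`** — `∃ C₁ C₂ > 0, R.WF2 → ∃ c₃′ U₀′, ∀ m, …: ≤ C₁·C₂^m·(2^{J′−k})^{m−1}·N`;
* **`klWtPinnedSumAt_klTowerIncr_remeasure_le_klEng_flow_all_uniform (R) (c″)`** — the tower instance.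
(The split / narrow-wide / abs weighted rows of Files E–G and the `_abs` rows are re-keyed the same way when the weighted kit instantiation needs them.)
Compositions of landed theorems; nothing about the model is asserted beyond them; nothing asserts (ℓ), any stub, K3 or superconductivity.
References: BGM 2006 §2.8 (2.82)–(2.84), (2.88)–(2.90) [cite: BenfattoGiulianiMastropietro2006].
-/

noncomputable section

namespace Summit.HubbardSuperconductivity.HubbardSuperconductivity.Theorems.EngineV8

set_option linter.dupNamespace false -- summit = problem name (single-conjunct summit), D-0017

open Classical
open Real Finset Literature.MathematicalPhysics.QuantumLattice Literature.Probability.LatticeModels GrassmannAlgebra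
open Literature.Probability.LatticeModels.BattleFederbush
open Literature.MathematicalPhysics.QuantumLattice.FermiRG
open Summit.HubbardSuperconductivity.HubbardSuperconductivity.Theorems.KLRegimeSplit
open Summit.HubbardSuperconductivity.HubbardSuperconductivity.Theorems.KLProgrammeLegKernels
open Summit.HubbardSuperconductivity.HubbardSuperconductivity.Theorems.DispersionFlow
open Summit.HubbardSuperconductivity.HubbardSuperconductivity.Theorems.KLRegimeWick
open Summit.HubbardSuperconductivity.HubbardSuperconductivity.Theorems.TorusFourierL2
open Summit.HubbardSuperconductivity.HubbardSuperconductivity.Theorems.PerturbedFermiCurve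

variable {L M : ℕ} [NeZero L] [NeZero M]

omit [NeZero L] [NeZero M] in
/-- **THE PER-PAIR RE-MEASURED ROW, weighted track, flow frame, no depth window — m-UNIFORM** (twin of `klWtPinnedSumAt_jump_le_klEng_flow_all`): `C₁, C₂` and the
thresholds fixed BEFORE the degree (`C₁ = 324·CJ·(D₀+1)`, `C₂ = 162·CJ`); for every `m` and the original binders, `… ≤ C₁·C₂^m·(2^{J′−k})^{m−1}·N`.
[cite: BenfattoGiulianiMastropietro2006, §2.8 (2.82)-(2.84), (2.88)-(2.90)] -/
theorem klWtPinnedSumAt_jump_le_klEng_flow_all_uniform (R : RenConsts) (c'' : ℝ) (hc'' : 0 ≤ c'') :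
    ∃ C₁ C₂ : ℝ, 0 < C₁ ∧ 0 < C₂ ∧ (R.WF2 → ∃ c₃' : ℝ, 0 < c₃' ∧ ∃ U₀' : ℝ, 0 < U₀' ∧ ∀ m : ℕ,
      ∀ (G : GeoConsts) (P : SplitConsts) (Q : EngConsts) (cc : ℝ), 0 < cc → cc ≤ klEngC₃6 P R → cc ≤ c₃' →
      ∀ μ ∈ klWindowC, ∀ U : ℝ, 0 < U → U ≤ min (klEngU₀3 P R cc) (1 / (R.Gfr 3 + 1)) → U ≤ U₀' → c'' * U ≤ 1 →
      ∀ β : ℝ, klBetaMin ≤ β → β ≤ Real.exp (cc / U ^ 2) →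
      ∀ (L M : ℕ) [NeZero L] [NeZero M], klEngL₃ β U ≤ L → klEngM₃ β U L ≤ M →
      ∀ n : ℕ, 1 ≤ n → n ≤ nScales β + 1 → IsKLRegime U cc (-(n : ℤ)) → HistP klPredsV17F2 L M G P Q R β U μ 0 n →
        (∀ m', 1 ≤ m' → m' < n → FlowPieceOscAt L M c'' β U μ m') →
        ∀ k J' : ℕ, k + 1 ≤ J' → J' ≤ n →
        ∀ T : HubbardGrassmann L M,
          (∀ (m' : ℕ) (X : Fin m' → HubbardFieldIdx L M), ∑ i, signedMomentum L (X i).2 (X i).1.1.2 ≠ 0 → kernel ℂ T m' X = 0) →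
        ∀ j : ℕ, J' ≤ j → ∀ (q : Fin (m + 1)) (w : SpaceTimeIdx L M × SectorLeg (sectorCount J')) (N : ℝ), 0 ≤ N →
          (∀ w' : SpaceTimeIdx L M × SectorLeg (sectorCount k),
            klWtPinnedSumAt L M β μ (klFlowFrameU L M β U μ n) k j (m + 1) T q w' ≤ N) →
          klWtPinnedSumAt L M β μ (klFlowFrameU L M β U μ n) J' j (m + 1) T q w ≤ C₁ * C₂ ^ m * ((2 : ℝ) ^ (J' - k)) ^ (m - 1) * N) := by
  obtain ⟨CJ, hCJ, hov⟩ := overlapWt_jump_sums_klEng_flow_all R c'' hc''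
  obtain ⟨D₀, hD₀, hreg⟩ := card_relCount_prescribed_lastLeg_klAniso_le_window_uniform
  refine ⟨324 * CJ * (D₀ + 1), 162 * CJ, by positivity, by positivity, fun hR2 => ?_⟩
  have hRj : ∀ j, 0 ≤ R.Gfr j := gfr_nonneg_of_wf2 hR2
  obtain ⟨c₃, hc₃, U₀, hU₀, hcnt⟩ := hreg R hRj
  refine ⟨c₃, hc₃, U₀, hU₀, ?_⟩
  intro m G P Q cc hcc hcc6 hcc₃' μ hμ U hU hUle hU₀' hcU β hβmin hβc L M _ _ hL3 hM3 n hn1 hnN hkl hhist hosc k J' hJ hJn T hT j hjJ q w N hN0 hN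
  have hD'0 : (0 : ℝ) ≤ (D₀ + 1) * ((m : ℝ) + 2) ^ 3 := by positivity
  have hβ : 0 < β := KLRegimeSplit.pos_of_klBetaMin_le hβmin
  set K : TrigPolyC4v := klFlowFrameU L M β U μ n with hK
  have hfr : FrameOK R U (nScales β) μ K := frameOK_klFlowFrameU_of_histP_le hR2 hn1 le_rfl hnN hhist
  obtain ⟨_, hcolJ, hrowJ⟩ := hov G P Q cc hR2 hcc hcc6 μ hμ U hU hUle hcU β hβmin hβc L M hL3 hM3 n hn1 hnN hkl hhist hosc k J' hJ hJn
  have hc₁0 : (0 : ℝ) ≤ 3 * CJ * M / β := by positivity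
  have hcol₁ : ∀ (ω'' : Fin (sectorCount J')) (ω' : Fin (sectorCount k)) (σ c : Fin 2) (x' : SpaceTimeIdx L M),
      ∑ x'' : SpaceTimeIdx L M, ‖(sectorAnalysisMatrix L M β (klAnisoFamily L M β μ K klE0 J') *
        sectorSubMatrix L M β (bgmFatMultiplier L M klE0 β (nambuXiCT L μ K) k)) (x'', ((ω'', σ), c)) (x', ((ω', σ), c))‖ *
          klScaleWt L M β j
            {latticeLegPos (2 * (2 * M)) ((x'', ((ω'', σ), c)) : SpaceTimeIdx L M × SectorLeg (sectorCount J')),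
              latticeLegPos (2 * (2 * M)) ((x', ((ω', σ), c)) : SpaceTimeIdx L M × SectorLeg (sectorCount k))} ≤ 3 * CJ * M / β := by
    intro ω'' ω' σ c x'
    refine le_trans (sum_le_sum fun x'' _ => mul_le_mul_of_nonneg_left (klScaleWt_le_of_le β hjJ _) (norm_nonneg _)) ?_
    exact hcolJ ω'' ω' σ c x'
  have hrow₁ : ∀ (ω'' : Fin (sectorCount J')) (ω' : Fin (sectorCount k)) (σ c : Fin 2) (x'' : SpaceTimeIdx L M),
      ∑ x' : SpaceTimeIdx L M, ‖(sectorAnalysisMatrix L M β (klAnisoFamily L M β μ K klE0 J') *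
        sectorSubMatrix L M β (bgmFatMultiplier L M klE0 β (nambuXiCT L μ K) k)) (x'', ((ω'', σ), c)) (x', ((ω', σ), c))‖ *
          klScaleWt L M β j
            {latticeLegPos (2 * (2 * M)) ((x'', ((ω'', σ), c)) : SpaceTimeIdx L M × SectorLeg (sectorCount J')),
              latticeLegPos (2 * (2 * M)) ((x', ((ω', σ), c)) : SpaceTimeIdx L M × SectorLeg (sectorCount k))} ≤ 3 * CJ * M / β := by
    intro ω'' ω' σ c x''
    refine le_trans (sum_le_sum fun x' _ => mul_le_mul_of_nonneg_left (klScaleWt_le_of_le β hjJ _) (norm_nonneg _)) ?_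
    exact hrowJ ω'' ω' σ c x''
  have hJN : J' ≤ nScales β + 1 := hJn.trans hnN
  have h := klWtPinnedSumAt_jump_le_of_consts hβ μ K hJ T hT j hc₁0 hc₁0 hD'0 hcol₁ hrow₁ m
    (fun E τ'' σ' => hcnt m cc hcc hcc₃' U hU hU₀' β hβmin hβc μ hμ μ K hfr L M k J' (by omega) _ subset_rfl E τ'' σ') q w hN0 hN
  have hMne : (M : ℝ) ≠ 0 := by exact_mod_cast NeZero.ne M
  have hεc : imagTimeWeight β M * (3 * CJ * M / β) = 3 * CJ / 2 := by
    unfold imagTimeWeight; field_simp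
  have hconst : (3 * CJ * M / β) ^ m * (3 * CJ * M / β) * imagTimeWeight β M ^ (m + 1) = (3 * CJ / 2) ^ (m + 1) := by
    rw [← pow_succ, ← mul_pow, mul_comm (3 * CJ * M / β), hεc]
  have hpoly : ((m : ℝ) + 2) ^ 3 ≤ 8 * 4 ^ m := Literature.NumberTheory.LFunctions.cube_le_eight_mul_four_pow m
  have hX0 : (0 : ℝ) ≤ ((2 : ℝ) ^ (J' - k)) ^ (m - 1) * N := by positivity
  calc klWtPinnedSumAt L M β μ K J' j (m + 1) T q w
      ≤ (3 * CJ * M / β) ^ m * (3 * CJ * M / β) * imagTimeWeight β M ^ (m + 1) * ((D₀ + 1) * ((m : ℝ) + 2) ^ 3 * 27 ^ (m + 1)) *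
          ((2 : ℝ) ^ (J' - k)) ^ (m - 1) * N := h
    _ = (3 * CJ / 2) ^ (m + 1) * ((D₀ + 1) * ((m : ℝ) + 2) ^ 3 * 27 ^ (m + 1)) * (((2 : ℝ) ^ (J' - k)) ^ (m - 1) * N) := by rw [hconst]; ring
    _ ≤ (3 * CJ / 2) ^ (m + 1) * ((D₀ + 1) * (8 * 4 ^ m) * 27 ^ (m + 1)) * (((2 : ℝ) ^ (J' - k)) ^ (m - 1) * N) := by gcongr
    _ = 324 * CJ * (D₀ + 1) * (162 * CJ) ^ m * ((2 : ℝ) ^ (J' - k)) ^ (m - 1) * N := by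
        have h32 : (3 * CJ / 2 : ℝ) ^ (m + 1) = (3 / 2 : ℝ) ^ m * CJ ^ m * (3 * CJ / 2) := by
          rw [pow_succ, show (3 * CJ / 2 : ℝ) = 3 / 2 * CJ by ring, mul_pow]
        have h27 : (27 : ℝ) ^ (m + 1) = 27 ^ m * 27 := pow_succ _ _
        have h162 : (162 * CJ : ℝ) ^ m = (3 / 2 : ℝ) ^ m * 4 ^ m * 27 ^ m * CJ ^ m := by
          rw [← mul_pow, ← mul_pow, ← mul_pow]; norm_num
        rw [h32, h27, h162]; ring

omit [NeZero L] [NeZero M] in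
/-- **THE INCREMENT `Δ_{k′}` RE-MEASURED AT `F_{dk−1}`, weighted track, flow frame, no depth window — m-UNIFORM** (twin of
`klWtPinnedSumAt_klTowerIncr_remeasure_le_klEng_flow_all`). [cite: BenfattoGiulianiMastropietro2006, §2.8 (2.82)-(2.84), (2.88)-(2.90)] -/
theorem klWtPinnedSumAt_klTowerIncr_remeasure_le_klEng_flow_all_uniform (R : RenConsts) (c'' : ℝ) (hc'' : 0 ≤ c'') :
    ∃ C₁ C₂ : ℝ, 0 < C₁ ∧ 0 < C₂ ∧ (R.WF2 → ∃ c₃' : ℝ, 0 < c₃' ∧ ∃ U₀' : ℝ, 0 < U₀' ∧ ∀ m : ℕ,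
      ∀ (G : GeoConsts) (P : SplitConsts) (Q : EngConsts) (cc : ℝ), 0 < cc → cc ≤ klEngC₃6 P R → cc ≤ c₃' →
      ∀ μ ∈ klWindowC, ∀ U : ℝ, 0 < U → U ≤ min (klEngU₀3 P R cc) (1 / (R.Gfr 3 + 1)) → U ≤ U₀' → c'' * U ≤ 1 →
      ∀ β : ℝ, klBetaMin ≤ β → β ≤ Real.exp (cc / U ^ 2) →
      ∀ (L M : ℕ) [NeZero L] [NeZero M], klEngL₃ β U ≤ L → klEngM₃ β U L ≤ M →
      ∀ n : ℕ, 1 ≤ n → n ≤ nScales β + 1 → IsKLRegime U cc (-(n : ℤ)) → HistP klPredsV17F2 L M G P Q R β U μ 0 n →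
        (∀ m', 1 ≤ m' → m' < n → FlowPieceOscAt L M c'' β U μ m') →
        ∀ d k k' : ℕ, 2 ≤ d → k' < k → d * k - 1 ≤ n →
        ∀ j : ℕ, d * k - 1 ≤ j → ∀ (q : Fin (m + 1)) (w : SpaceTimeIdx L M × SectorLeg (sectorCount (d * k - 1))),
          klWtPinnedSumAt L M β μ (klFlowFrameU L M β U μ n) (d * k - 1) j (m + 1)
              (klTowerIncr L M β U μ (klFlowFrameU L M β U μ n) d k') q w ≤
            C₁ * C₂ ^ m * ((2 : ℝ) ^ (d * k - 1 - d * k')) ^ (m - 1) *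
              klTowerBornWtAt L M β U μ (klFlowFrameU L M β U μ n) d k' j (m + 1)) := by
  obtain ⟨C₁, C₂, hC₁, hC₂, h⟩ := klWtPinnedSumAt_jump_le_klEng_flow_all_uniform R c'' hc''
  refine ⟨C₁, C₂, hC₁, hC₂, fun hR2 => ?_⟩
  obtain ⟨c₃, hc₃, U₀, hU₀, h'⟩ := h hR2
  refine ⟨c₃, hc₃, U₀, hU₀, ?_⟩
  intro m G P Q cc hcc hcc6 hcc₃' μ hμ U hU hUle hU₀' hcU β hβmin hβc L M _ _ hL3 hM3 n hn1 hnN hkl hhist hosc d k k' hd hk hkn j hj q w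
  have hβ : 0 < β := KLRegimeSplit.pos_of_klBetaMin_le hβmin
  exact h' m G P Q cc hcc hcc6 hcc₃' μ hμ U hU hUle hU₀' hcU β hβmin hβc L M hL3 hM3 n hn1 hnN hkl hhist hosc (d * k') (d * k - 1) (block_jump_le hd hk) hkn
    (klTowerIncr L M β U μ _ d k') (fun m' X hX => klTowerIncr_momentumConserving β U μ _ d k' m' X hX) j hj q w
    (klTowerBornWtAt L M β U μ _ d k' j (m + 1)) (klTowerBornWtAt_nonneg hβ.le U μ _ d k' j (m + 1))
    (fun w' => klWtPinnedSumAt_le_klTowerBornWtAt β U μ _ d k' j (m + 1) q w')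

end Summit.HubbardSuperconductivity.HubbardSuperconductivity.Theorems.EngineV8

end
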